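import Mathlib.Analysis.InnerProductSpace.PiL2
import Mathlib.Dynamics.OmegaLimit
import Literature.Probability.Process.LocalRubberCompact

/-!
# Crux `GappedShellCensus.CleanLimitExtractionR` (stmt-AtomisticToContinuum-18072), line
# `CleanLimitExtractionR_CandidateProof` — stub C₂ `stub_cleRHullDictionary`

THE HULL of a sequence of finite configurations `x N : Fin N → ℝ³` is the Mathlib ω-limit
(`omegaLimit atTop`), as the particle number `N → ∞`, of the family of ALL re-rootings
`⟨range (x N)⟩.translate t`, `t ∈ ℝ³`, in the compact pseudometric space `LocalConfig ℝ³` of the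
local rubber topology (`Literature/Probability/Process/LocalRubber*`):
`⋂_{N₀} closure {⟨range (x N)⟩.translate t | N ≥ N₀, t}`.  This file is the DICTIONARY between hull
membership and the matching clause of `GappedShellCensus.CleanLocalLimit`: a hull member is the
limit of re-rooted clusters along a STRICTLY INCREASING subsequence of the given `x`
(`cleR_exists_seq_of_mem_hull`: `mem_omegaLimit_iff_frequently` + metric balls +
`Filter.extraction_forall_of_frequently`), and such convergence IS eventual two-way `ε`-matching on
every ball (`cleR_cll_clause_of_tendsto`: `LocalConfig.tendsto_iff_locallyMatches`).
Ported from the checked crux workfile `Cruxes/CleanLimitExtractionR/SketchIdeator2.lean` (crux-ideate,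
ideator 2; farm rc 0, H21 audit `proof-of-item closed:true`); the route's clauses (gapped-twelve,
fcc/hcp-typed shell, clean site) are written out verbatim — no definitions, no notations.
-/

noncomputable section

namespace Summit.AtomisticToContinuum.Crystallization.Theorems

open Filter Topology Set
open scoped Classical
open Literature.Probability.Process

variable {x : (N : ℕ) → (Fin N → EuclideanSpace ℝ (Fin 3))} {Y : LocalConfig (EuclideanSpace ℝ (Fin 3))}

/-- DICTIONARY, sequential form: a member of the hull is the limit of re-rooted clusters along a
STRICTLY INCREASING subsequence of THE GIVEN `x` (`mem_omegaLimit_iff_frequently` + metric balls +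
`Filter.extraction_forall_of_frequently`). -/
theorem cleR_exists_seq_of_mem_hull (hY : Y ∈ omegaLimit atTop
      (fun N (t : EuclideanSpace ℝ (Fin 3)) => (⟨Set.range (x N)⟩ : LocalConfig (EuclideanSpace ℝ (Fin 3))).translate t) Set.univ) :
    ∃ (φ : ℕ → ℕ) (t : ℕ → EuclideanSpace ℝ (Fin 3)), StrictMono φ ∧
      Tendsto (fun k => ((⟨Set.range (x (φ k))⟩ : LocalConfig (EuclideanSpace ℝ (Fin 3)))).translate (t k)) atTop (𝓝 Y) := by
  have hfr : ∀ k : ℕ, ∃ᶠ N in atTop, ∃ t : EuclideanSpace ℝ (Fin 3),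
      dist (((⟨Set.range (x N)⟩ : LocalConfig (EuclideanSpace ℝ (Fin 3)))).translate t) Y < 1 / ((k : ℝ) + 1) := by
    intro k
    have h := (mem_omegaLimit_iff_frequently _ _ _ Y).1 hY (Metric.ball Y (1 / ((k : ℝ) + 1)))
      (Metric.ball_mem_nhds _ (by positivity))
    refine h.mono fun N hN => ?_
    obtain ⟨t, -, ht⟩ := hN
    exact ⟨t, Metric.mem_ball.1 ht⟩
  obtain ⟨φ, hφ, hP⟩ := extraction_forall_of_frequently hfr
  choose t ht using hP
  refine ⟨φ, t, hφ, ?_⟩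
  rw [Metric.tendsto_atTop]
  intro ε hε
  obtain ⟨K, hK⟩ := exists_nat_one_div_lt hε
  refine ⟨K, fun k hk => lt_of_lt_of_le (ht k) ?_⟩
  have hk' : (K : ℝ) + 1 ≤ (k : ℝ) + 1 := by
    have : (K : ℝ) ≤ k := by exact_mod_cast hk
    linarith
  have : (1 : ℝ) / ((k : ℝ) + 1) ≤ 1 / ((K : ℝ) + 1) :=
    one_div_le_one_div_of_le (by positivity) hk'
  linarith

/-- DICTIONARY, matching form: convergence of re-rooted clusters IS the two-way matching clause of
`CleanLocalLimit` (`LocalConfig.tendsto_iff_locallyMatches`; translation `τ n = -t n`). -/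
theorem cleR_cll_clause_of_tendsto {φ : ℕ → ℕ} {t : ℕ → EuclideanSpace ℝ (Fin 3)}
    (h : Tendsto (fun k => ((⟨Set.range (x (φ k))⟩ : LocalConfig (EuclideanSpace ℝ (Fin 3)))).translate (t k)) atTop (𝓝 Y)) :
    ∀ R ε : ℝ, 0 < ε → ∀ᶠ n in atTop,
      (∀ y ∈ (Y : Set (EuclideanSpace ℝ (Fin 3))), ‖y‖ ≤ R → ∃ i : Fin (φ n), dist (x (φ n) i + -t n) y ≤ ε) ∧
      (∀ i : Fin (φ n), ‖x (φ n) i + -t n‖ ≤ R →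
        ∃ y ∈ (Y : Set (EuclideanSpace ℝ (Fin 3))), dist (x (φ n) i + -t n) y ≤ ε) := by
  intro R ε hε
  filter_upwards [LocalConfig.tendsto_iff_locallyMatches.1 h R ε hε] with n hn
  obtain ⟨h1, h2⟩ := hn
  have hmem : ∀ i : Fin (φ n), x (φ n) i + -t n ∈ ((
      (⟨Set.range (x (φ n))⟩ : LocalConfig (EuclideanSpace ℝ (Fin 3)))).translate (t n) : Set (EuclideanSpace ℝ (Fin 3))) := by
    intro i
    simp only [LocalConfig.coe_translate, LocalConfig.coe_mk]
    exact ⟨x (φ n) i, ⟨i, rfl⟩, sub_eq_add_neg _ _⟩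
  refine ⟨fun y hy hyR => ?_, fun i hi => ?_⟩
  · obtain ⟨p, hp, hyp⟩ := h2 y hy hyR
    simp only [LocalConfig.coe_translate, LocalConfig.coe_mk] at hp
    obtain ⟨z, ⟨i, rfl⟩, rfl⟩ := hp
    exact ⟨i, by rw [← sub_eq_add_neg, dist_comm]; exact hyp⟩
  · obtain ⟨q, hq, hqp⟩ := h1 (x (φ n) i + -t n) (hmem i) hi
    exact ⟨q, hq, by rw [dist_comm]; exact hqp⟩

/-- **Stub C₂ — THE HULL DICTIONARY**: a member `Y` of the hull of `x` (the ω-limit, as `N → ∞`, of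
all re-rootings `⟨range (x N)⟩.translate t` in the compact rubber space `LocalConfig ℝ³`) satisfies
the matching clause of `CleanLocalLimit`: along a strictly increasing subsequence `φ` and
translations `t n`, the translated clusters `x (φ n) · + t n` and `Y` are two-way `ε`-matched on
`B̄(0, R)` eventually, for all `R` and all `ε > 0`. -/
theorem stub_cleRHullDictionary (hY : Y ∈ omegaLimit atTop
      (fun N (t : EuclideanSpace ℝ (Fin 3)) => (⟨Set.range (x N)⟩ : LocalConfig (EuclideanSpace ℝ (Fin 3))).translate t) Set.univ) :
    ∃ (φ : ℕ → ℕ) (t : ℕ → EuclideanSpace ℝ (Fin 3)), StrictMono φ ∧ ∀ R ε : ℝ, 0 < ε → ∀ᶠ n in atTop,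
      (∀ y ∈ (Y : Set (EuclideanSpace ℝ (Fin 3))), ‖y‖ ≤ R → ∃ i : Fin (φ n), dist (x (φ n) i + t n) y ≤ ε) ∧
      (∀ i : Fin (φ n), ‖x (φ n) i + t n‖ ≤ R →
        ∃ y ∈ (Y : Set (EuclideanSpace ℝ (Fin 3))), dist (x (φ n) i + t n) y ≤ ε) := by
  obtain ⟨φ, t, hφ, hT⟩ := cleR_exists_seq_of_mem_hull hY
  exact ⟨φ, fun n => -t n, hφ, cleR_cll_clause_of_tendsto hT⟩

end Summit.AtomisticToContinuum.Crystallization.Theorems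

end
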